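import Summits.BirchSwinnertonDyer.BirchSwinnertonDyer.Theorems.ResidualThetaTransportAtTwoThetaLayerLambdaCongruenceAtTwoCurveEulerHecke
import Summits.BirchSwinnertonDyer.BirchSwinnertonDyer.Theorems.ResidualThetaTransportAtTwoThetaLayerLambdaCongruenceAtTwoDepletionExact
import Literature.NumberTheory.EllipticCurves.PAdicLFunctionInterpolationHoldsProofs
import Literature.NumberTheory.EllipticCurves.ModularSymbolsManinDrinfeldGeneralProofs
import Literature.NumberTheory.EllipticCurves.LeadingTermPPartProofs
import Literature.NumberTheory.EllipticCurves.AnalyticRankOrderProofs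
import HarnessLib

/-!
# Crux `ThetaLayerLambdaCongruenceAtTwo` (stmt-BirchSwinnertonDyer-20688, route ResidualThetaTransportAtTwo), line
# `birth`: the curve's `S₀`-depleted plus symbol admits a PRIMITIVE `2`-adic scaling (bounded denominators +
# non-vanishing at the cusp `0` from `L(W,1) ≠ 0`) (width prover bsd-wall-rtt-p3-w2 g0; `--supports stmt-BirchSwinnertonDyer-20688
# --as helper`; closes nothing)

HONEST FRAMING. THEOREMS of the tree's definitions only; nothing about any curve or form is asserted beyond the
hypotheses (`IsNewformOf W f`, `W.analyticRank = 0`); BSD is not proved by any of this.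

WHAT (lead rtt-p3 g2's assignment (b), 2026-08-27T23:11Z). Let `φ^{S₀}_W(x) = ∑_{k : S₀ → {0,1,2}} (∏_v c_{v,k_v} ℓ_v^{−k_v})
· [x·∏_v ℓ_v^{k_v}]⁺_f ∈ ℚ̄₂` be the curve's depleted rational plus symbol EXACTLY as in
`depletedCurveLayer_eq_layerSum_depletedSymbol` (Euler polynomials `L_v(W,X)`, `f` the newform of `W`, `S₀` odd places).
THEN `∃ c ∈ ℚ̄₂, ∀ x ‖c·φ^{S₀}_W(x)‖ ≤ 1 ∧ ∃ x ‖c·φ^{S₀}_W(x)‖ = 1` (`exists_primitive_scaling_depletedCurveSymbol`):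
(§1) `φ^{S₀}_W` is the `2`-adic image of a ℚ-valued function with BOUNDED DENOMINATORS (`[r]⁺_f ∈ (1/D)ℤ`, Manin–Drinfeld,
tree theorem `exists_forall_ratPlusSymbol_eq_div_of_maninDrinfeld` + `exists_nsmul_modularSymbol_mem_periodLattice_holds`;
the Euler coefficients are integers over odd `ℓ_v`), so its values have `2`-adic valuations in a set of integers bounded
below; (§2) it does not vanish at `x = 0`: `φ^{S₀}_W(0) = (∏_v L_v(W, ℓ_v⁻¹))·[0]⁺_f` with `[0]⁺_f·Ω⁺_f = L(W,1) ≠ 0`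
(`analyticRank W = 0`, `analyticRank_eq_zero_iff_holds`, `IsNewformOf.entireLFunction_one_eq`) and `L_v(W, ℓ⁻¹) =
(ℓ − a_ℓ + 𝟙_good)/ℓ ≠ 0` (`N_ℓ = ℓ + 1 − a_ℓ > 0` at good `ℓ`, `reductionPointCount_pos`; `a_ℓ ∈ {0, ±1}` at bad odd `ℓ`);
(§3) hence a value of MAXIMAL norm exists and its inverse is the primitive scaling. This is the `W`-side normalisation
input of the lead's (C3)/(H-sym-min) glue (the habitat's `r_an = 0` binder is used exactly here).

References: [Manin1972] Cor. 3.6; [MazurTateTeitelbaum1986Invent] §I.8; [SilvermanAEC2009] §C.16, V.2.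
-/

noncomputable section

-- justification: the `Summit.BirchSwinnertonDyer.BirchSwinnertonDyer.…` path repeats a component (route-file convention)
set_option linter.dupNamespace false

open scoped Classical

open Polynomial

open Literature.NumberTheory.EllipticCurves Literature.NumberTheory.EllipticCurves.ModularForms

namespace Summit.BirchSwinnertonDyer.BirchSwinnertonDyer.Theorems.ThetaLayerLambdaCongruenceAtTwo

section Primitive

variable {W : WeierstrassCurve ℚ} {N : ℕ} {f : CuspForm (CongruenceSubgroup.Gamma0 N) 2}

/-! ## §1. Rational values with bounded denominators -/

/-- The `2`-adic norm of a rational number `z / B` with `B` odd is `‖z‖₂ ≤ 1`; more precisely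
`‖algebraMap ℚ ℚ̄₂ q‖ = padicNorm 2 q`. [folklore] -/
theorem norm_algebraMap_rat_padicAlgCl (q : ℚ) : ‖algebraMap ℚ (PadicAlgCl 2) q‖ = (padicNorm 2 q : ℝ) := by
  rw [show algebraMap ℚ (PadicAlgCl 2) q = algebraMap ℚ_[2] (PadicAlgCl 2) (q : ℚ_[2]) by
    rw [map_ratCast, eq_ratCast]]
  rw [PadicAlgCl.norm_extends, Padic.eq_padicNorm]

/-- For a non-zero integer `z`, `‖z‖₂ = 2^{-v₂(z)}` in `ℚ̄₂`. [folklore] -/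
theorem norm_intCast_padicAlgCl_two_eq_zpow {z : ℤ} (hz : z ≠ 0) :
    ‖(z : PadicAlgCl 2)‖ = (2 : ℝ) ^ (-(padicValInt 2 z : ℤ)) := by
  rw [← map_intCast (algebraMap ℚ (PadicAlgCl 2)) z, norm_algebraMap_rat_padicAlgCl,
    padicNorm.eq_zpow_of_nonzero (by exact_mod_cast hz), padicValRat.of_int]
  push_cast
  rfl

/-- An odd natural number is a `2`-adic unit (norm form for casts from `ℚ`). [folklore] -/
theorem norm_algebraMap_natCast_eq_one_of_odd {B : ℕ} (hB : ¬ 2 ∣ B) :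
    ‖algebraMap ℚ (PadicAlgCl 2) (B : ℚ)‖ = 1 := by
  rw [map_natCast]
  exact norm_natCast_padicAlgCl_two_eq_one hB

/-! ## §2. The depleted curve symbol: rational form, bounded denominators, value at `0` -/

/-- **Rational form.** The `2`-adic depleted curve symbol is the image of the ℚ-valued function
`ρ(x) = ∑_k (∏_v L_v.coeff(k_v)·ℓ_v^{−k_v})·[x·∏ℓ^{k}]⁺_f`. [folklore] -/
theorem depletedCurveSymbol_eq_algebraMap (S₀ : Finset (IsDedekindDomain.HeightOneSpectrum (NumberField.RingOfIntegers ℚ)))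
    (x : ℚ) :
    (∑ k ∈ Fintype.piFinset (fun _ : S₀ ↦ Finset.range 3),
        (∏ v : S₀, ((W.localPolynomialAt (v : IsDedekindDomain.HeightOneSpectrum (NumberField.RingOfIntegers ℚ))).map (Int.castRingHom (PadicAlgCl 2))).coeff (k v) *
            ((Rat.HeightOneSpectrum.natGenerator (v : IsDedekindDomain.HeightOneSpectrum (NumberField.RingOfIntegers ℚ)) : PadicAlgCl 2)⁻¹) ^ (k v)) *
          algebraMap ℚ (PadicAlgCl 2) (ratPlusSymbol f (x * ((∏ v : S₀, Rat.HeightOneSpectrum.natGenerator (v : IsDedekindDomain.HeightOneSpectrum (NumberField.RingOfIntegers ℚ)) ^ (k v) : ℕ) : ℚ)))) =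
      algebraMap ℚ (PadicAlgCl 2) (∑ k ∈ Fintype.piFinset (fun _ : S₀ ↦ Finset.range 3),
        (∏ v : S₀, ((W.localPolynomialAt (v : IsDedekindDomain.HeightOneSpectrum (NumberField.RingOfIntegers ℚ))).coeff (k v) : ℚ) *
            ((Rat.HeightOneSpectrum.natGenerator (v : IsDedekindDomain.HeightOneSpectrum (NumberField.RingOfIntegers ℚ)) : ℚ)⁻¹) ^ (k v)) *
          ratPlusSymbol f (x * ((∏ v : S₀, Rat.HeightOneSpectrum.natGenerator (v : IsDedekindDomain.HeightOneSpectrum (NumberField.RingOfIntegers ℚ)) ^ (k v) : ℕ) : ℚ))) := by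
  rw [map_sum]
  refine Finset.sum_congr rfl fun k _ ↦ ?_
  rw [map_mul, map_prod]
  congr 1
  refine Finset.prod_congr rfl fun v _ ↦ ?_
  rw [map_mul, map_pow, map_inv₀, map_natCast, coeff_map, eq_intCast, ← map_intCast (algebraMap ℚ (PadicAlgCl 2))]

/-- **Bounded denominators.** With `D` a common denominator of the `[r]⁺_f` (`[r]⁺_f ∈ (1/D)ℤ` for all `r`) and
`L = ∏_{v∈S₀} ℓ_v`, every value `ρ(x)` of the rational depleted curve symbol lies in `(1/(D·L²))ℤ`. [cite: Manin1972, Cor. 3.6] -/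
theorem exists_int_depletedCurveSymbolRat (S₀ : Finset (IsDedekindDomain.HeightOneSpectrum (NumberField.RingOfIntegers ℚ)))
    {D : ℕ} (hDpos : 0 < D) (hD : ∀ r : ℚ, ∃ m : ℤ, ratPlusSymbol f r = (m : ℚ) / D) (x : ℚ) :
    ∃ z : ℤ, (∑ k ∈ Fintype.piFinset (fun _ : S₀ ↦ Finset.range 3),
        (∏ v : S₀, ((W.localPolynomialAt (v : IsDedekindDomain.HeightOneSpectrum (NumberField.RingOfIntegers ℚ))).coeff (k v) : ℚ) *
            ((Rat.HeightOneSpectrum.natGenerator (v : IsDedekindDomain.HeightOneSpectrum (NumberField.RingOfIntegers ℚ)) : ℚ)⁻¹) ^ (k v)) *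
          ratPlusSymbol f (x * ((∏ v : S₀, Rat.HeightOneSpectrum.natGenerator (v : IsDedekindDomain.HeightOneSpectrum (NumberField.RingOfIntegers ℚ)) ^ (k v) : ℕ) : ℚ))) *
      ((D * (∏ v : S₀, Rat.HeightOneSpectrum.natGenerator (v : IsDedekindDomain.HeightOneSpectrum (NumberField.RingOfIntegers ℚ))) ^ 2 : ℕ) : ℚ) = z := by
  -- choose numerators
  choose m hm using hD
  have hD0 : (D : ℚ) ≠ 0 := by exact_mod_cast hDpos.ne'
  refine ⟨∑ k ∈ Fintype.piFinset (fun _ : S₀ ↦ Finset.range 3),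
      (∏ v : S₀, (W.localPolynomialAt (v : IsDedekindDomain.HeightOneSpectrum (NumberField.RingOfIntegers ℚ))).coeff (k v) *
          (Rat.HeightOneSpectrum.natGenerator (v : IsDedekindDomain.HeightOneSpectrum (NumberField.RingOfIntegers ℚ)) : ℤ) ^ (2 - k v)) *
        m (x * ((∏ v : S₀, Rat.HeightOneSpectrum.natGenerator (v : IsDedekindDomain.HeightOneSpectrum (NumberField.RingOfIntegers ℚ)) ^ (k v) : ℕ) : ℚ)), ?_⟩
  rw [Finset.sum_mul, Int.cast_sum]
  refine Finset.sum_congr rfl fun k hk ↦ ?_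
  have hk' : ∀ v : S₀, k v ≤ 2 := fun v ↦ by
    have := Fintype.mem_piFinset.mp hk v
    rw [Finset.mem_range] at this
    omega
  -- rearrange: (∏ c ℓ⁻ᵏ) · (m/D) · (D L²) = (∏ c ℓ^{2−k}) · m
  have hprod : (∏ v : S₀, ((W.localPolynomialAt (v : IsDedekindDomain.HeightOneSpectrum (NumberField.RingOfIntegers ℚ))).coeff (k v) : ℚ) *
        ((Rat.HeightOneSpectrum.natGenerator (v : IsDedekindDomain.HeightOneSpectrum (NumberField.RingOfIntegers ℚ)) : ℚ)⁻¹) ^ (k v)) *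
      (((∏ v : S₀, Rat.HeightOneSpectrum.natGenerator (v : IsDedekindDomain.HeightOneSpectrum (NumberField.RingOfIntegers ℚ))) ^ 2 : ℕ) : ℚ) =
      ((∏ v : S₀, ((W.localPolynomialAt (v : IsDedekindDomain.HeightOneSpectrum (NumberField.RingOfIntegers ℚ))).coeff (k v) *
          (Rat.HeightOneSpectrum.natGenerator (v : IsDedekindDomain.HeightOneSpectrum (NumberField.RingOfIntegers ℚ)) : ℤ) ^ (2 - k v)) : ℤ) : ℚ) := by
    push_cast
    rw [← Finset.prod_pow, ← Finset.prod_mul_distrib]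
    refine Finset.prod_congr rfl fun v _ ↦ ?_
    have hℓ : (Rat.HeightOneSpectrum.natGenerator (v : IsDedekindDomain.HeightOneSpectrum (NumberField.RingOfIntegers ℚ)) : ℚ) ≠ 0 := by
      exact_mod_cast (Rat.HeightOneSpectrum.prime_natGenerator _).ne_zero
    have e2 : (Rat.HeightOneSpectrum.natGenerator (v : IsDedekindDomain.HeightOneSpectrum (NumberField.RingOfIntegers ℚ)) : ℚ) ^ 2 =
        (Rat.HeightOneSpectrum.natGenerator (v : IsDedekindDomain.HeightOneSpectrum (NumberField.RingOfIntegers ℚ)) : ℚ) ^ (k v) *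
        (Rat.HeightOneSpectrum.natGenerator (v : IsDedekindDomain.HeightOneSpectrum (NumberField.RingOfIntegers ℚ)) : ℚ) ^ (2 - k v) := by
      rw [← pow_add]; congr 1; have := hk' v; omega
    rw [e2, inv_pow]
    field_simp
  rw [hm, Int.cast_mul, ← hprod]
  push_cast
  field_simp

/-- **The value at `0`**: `ρ(0) = (∏_{v∈S₀} L_v(W, ℓ_v⁻¹)) · [0]⁺_f` (all dilates of `0` are `0`; the coefficient sum
factorises as the product of the Euler polynomials evaluated at `ℓ_v⁻¹`). [cite: SilvermanAEC2009, §C.16] -/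
theorem depletedCurveSymbol_zero_eq (S₀ : Finset (IsDedekindDomain.HeightOneSpectrum (NumberField.RingOfIntegers ℚ))) :
    (∑ k ∈ Fintype.piFinset (fun _ : S₀ ↦ Finset.range 3),
        (∏ v : S₀, ((W.localPolynomialAt (v : IsDedekindDomain.HeightOneSpectrum (NumberField.RingOfIntegers ℚ))).map (Int.castRingHom (PadicAlgCl 2))).coeff (k v) *
            ((Rat.HeightOneSpectrum.natGenerator (v : IsDedekindDomain.HeightOneSpectrum (NumberField.RingOfIntegers ℚ)) : PadicAlgCl 2)⁻¹) ^ (k v)) *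
          algebraMap ℚ (PadicAlgCl 2) (ratPlusSymbol f (0 * ((∏ v : S₀, Rat.HeightOneSpectrum.natGenerator (v : IsDedekindDomain.HeightOneSpectrum (NumberField.RingOfIntegers ℚ)) ^ (k v) : ℕ) : ℚ)))) =
      (∏ v ∈ S₀, ((W.localPolynomialAt v).map (Int.castRingHom (PadicAlgCl 2))).eval
          ((Rat.HeightOneSpectrum.natGenerator v : PadicAlgCl 2)⁻¹)) *
        algebraMap ℚ (PadicAlgCl 2) (ratPlusSymbol f 0) := by
  simp only [zero_mul]
  rw [← Finset.sum_mul]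
  congr 1
  rw [← Finset.prod_coe_sort S₀]
  have heval : ∀ v : S₀, ((W.localPolynomialAt (v : IsDedekindDomain.HeightOneSpectrum (NumberField.RingOfIntegers ℚ))).map
      (Int.castRingHom (PadicAlgCl 2))).eval ((Rat.HeightOneSpectrum.natGenerator
        (v : IsDedekindDomain.HeightOneSpectrum (NumberField.RingOfIntegers ℚ)) : PadicAlgCl 2)⁻¹) =
      ∑ k ∈ Finset.range 3, ((W.localPolynomialAt (v : IsDedekindDomain.HeightOneSpectrum (NumberField.RingOfIntegers ℚ))).map
        (Int.castRingHom (PadicAlgCl 2))).coeff k * ((Rat.HeightOneSpectrum.natGenerator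
          (v : IsDedekindDomain.HeightOneSpectrum (NumberField.RingOfIntegers ℚ)) : PadicAlgCl 2)⁻¹) ^ k := fun v ↦
    eval_eq_sum_range' (lt_of_le_of_lt ((natDegree_map_le).trans
      (WeierstrassCurve.natDegree_localPolynomial_le_two _)) (by norm_num)) _
  simp_rw [heval]
  rw [Finset.prod_univ_sum]

/-- **`L_v(W, ℓ_v⁻¹) ≠ 0` in `ℚ̄₂`** for every finite place `v` of `ℚ` with `ℓ_v` odd: `L_v(ℓ⁻¹) = N_ℓ/ℓ` at a good place
(`N_ℓ = #Ẽ(𝔽_ℓ) > 0`, `reductionPointCount_pos`), `(ℓ ∓ 1)/ℓ` at a multiplicative and `1` at an additive place.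
[cite: SilvermanAEC2009, §C.16 and V.2] -/
theorem eval_inv_localPolynomialAt_ne_zero [W.IsElliptic] [W.IsGloballyMinimal]
    (v : IsDedekindDomain.HeightOneSpectrum (NumberField.RingOfIntegers ℚ))
    (h2 : ¬ 2 ∣ Rat.HeightOneSpectrum.natGenerator v) :
    ((W.localPolynomialAt v).map (Int.castRingHom (PadicAlgCl 2))).eval
        ((Rat.HeightOneSpectrum.natGenerator v : PadicAlgCl 2)⁻¹) ≠ 0 := by
  have hp := Rat.HeightOneSpectrum.prime_natGenerator v
  have hℓ0 : (Rat.HeightOneSpectrum.natGenerator v : PadicAlgCl 2) ≠ 0 := by exact_mod_cast hp.ne_zero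
  have h3 : 3 ≤ Rat.HeightOneSpectrum.natGenerator v := by
    rcases hp.eq_two_or_odd' with h | ⟨k, hk⟩
    · exact absurd (h ▸ dvd_rfl) h2
    · have := hp.two_le; omega
  rw [map_localPolynomialAt_eq W v]
  split_ifs with hbad
  · -- bad place: `L_v(ℓ⁻¹) = 1 − a_ℓ ℓ⁻¹` with `a_ℓ ∈ {1, −1, 0}` and `ℓ ≥ 3`
    simp only [zero_mul, add_zero, eval_sub, eval_one, eval_mul, eval_C, eval_X]
    intro h
    rw [sub_eq_zero, eq_comm, mul_inv_eq_one₀ hℓ0] at h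
    have hint : W.LFunction (Rat.HeightOneSpectrum.natGenerator v) = (Rat.HeightOneSpectrum.natGenerator v : ℤ) := by
      exact_mod_cast h
    have hngood : ¬ W.HasGoodReductionAt v := (WeierstrassCurve.dvd_conductorNorm_iff W v).mp hbad
    have ha : W.LFunction (Rat.HeightOneSpectrum.natGenerator v) = 1 ∨ W.LFunction (Rat.HeightOneSpectrum.natGenerator v) = -1 ∨
        W.LFunction (Rat.HeightOneSpectrum.natGenerator v) = 0 := by
      rw [← coe_primesEquiv_eq_natGenerator]
      rcases WeierstrassCurve.hasGoodReductionAt_or_hasMultiplicativeReductionAt_or_hasAdditiveReductionAt v W with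
          hg | hm | ha
      · exact absurd hg hngood
      · by_cases hs : W.HasSplitMultiplicativeReductionAt v
        · exact Or.inl (W.LFunction_apply_primesEquiv_of_hasSplitMultiplicativeReductionAt hs)
        · exact Or.inr (Or.inl (W.LFunction_apply_primesEquiv_of_hasMultiplicativeReductionAt_of_not_split hm hs))
      · exact Or.inr (Or.inr (W.LFunction_apply_primesEquiv_of_hasAdditiveReductionAt ha))
    rcases ha with ha | ha | ha <;> rw [ha] at hint <;> omega
  · -- good place: `ℓ · L_v(ℓ⁻¹) = ℓ − a_ℓ + 1 = N_ℓ > 0`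
    simp only [eval_add, eval_sub, eval_one, eval_mul, eval_C, eval_X, eval_pow]
    intro h
    have e : (1 : PadicAlgCl 2) - (W.LFunction (Rat.HeightOneSpectrum.natGenerator v) : PadicAlgCl 2) *
        (Rat.HeightOneSpectrum.natGenerator v : PadicAlgCl 2)⁻¹ +
        (Rat.HeightOneSpectrum.natGenerator v : PadicAlgCl 2) * ((Rat.HeightOneSpectrum.natGenerator v : PadicAlgCl 2)⁻¹) ^ 2 =
      ((Rat.HeightOneSpectrum.natGenerator v : PadicAlgCl 2) - (W.LFunction (Rat.HeightOneSpectrum.natGenerator v) : PadicAlgCl 2) + 1) *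
        (Rat.HeightOneSpectrum.natGenerator v : PadicAlgCl 2)⁻¹ := by
      field_simp
    rw [e, mul_eq_zero, inv_eq_zero] at h
    rcases h with h | h
    · have hgood : W.HasGoodReductionAt v := by
        by_contra hng; exact hbad ((WeierstrassCurve.dvd_conductorNorm_iff W v).mpr hng)
      haveI : Fact (Rat.HeightOneSpectrum.natGenerator v).Prime := ⟨hp⟩
      have ha : W.LFunction (Rat.HeightOneSpectrum.natGenerator v) = W.frobeniusTrace (Rat.HeightOneSpectrum.natGenerator v) :=
        WeierstrassCurve.LFunction_apply_prime_eq_frobeniusTrace W _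
          ((WeierstrassCurve.hasGoodReductionAtPrime_iff_hasGoodReductionAt_ringOfIntegers v W).mpr hgood)
      rw [ha, WeierstrassCurve.frobeniusTrace] at h
      push_cast at h
      have hN : ((W.reductionPointCount (Rat.HeightOneSpectrum.natGenerator v) : ℕ) : PadicAlgCl 2) = 0 := by
        rw [← h]; ring
      have hpos := W.reductionPointCount_pos (Rat.HeightOneSpectrum.natGenerator v)
      exact absurd (by exact_mod_cast hN : W.reductionPointCount (Rat.HeightOneSpectrum.natGenerator v) = 0) hpos.ne'
    · exact hℓ0 h

/-! ## §3. The primitive scaling -/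

/-- **PRIMITIVE SCALING of the curve's depleted plus symbol** (lead rtt-p3 g2's assignment (b)). For the newform `f`
of a curve `W/ℚ` of analytic rank `0` and any finite set `S₀` of ODD places, the `2`-adic depleted rational plus
symbol `φ^{S₀}_W` (exact form of `depletedCurveLayer_eq_layerSum_depletedSymbol`) admits `c ∈ ℚ̄₂` with
`‖c·φ^{S₀}_W(x)‖ ≤ 1` for all `x` and `= 1` for some `x`: the values are `2`-adic images of rationals with a common
denominator (§2, Manin–Drinfeld), they do not all vanish (`φ^{S₀}_W(0) = ∏_v L_v(W,ℓ_v⁻¹)·[0]⁺_f ≠ 0` as `L(W,1) ≠ 0`),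
so a value of maximal norm exists (least `2`-adic valuation of the numerators) and `c` is its inverse.
[cite: MazurTateTeitelbaum1986Invent, §I.8 (bounded denominators of [r]⁺)] -/
theorem exists_primitive_scaling_depletedCurveSymbol [W.IsElliptic] [W.IsGloballyMinimal] [NeZero N]
    (hf : IsNewformOf W f) (hr : W.analyticRank = 0)
    (S₀ : Finset (IsDedekindDomain.HeightOneSpectrum (NumberField.RingOfIntegers ℚ)))
    (hS2 : ∀ v ∈ S₀, ((2 : ℕ) : NumberField.RingOfIntegers ℚ) ∉ v.asIdeal) :
    ∃ c : PadicAlgCl 2,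
      (∀ x : ℚ, ‖c * (∑ k ∈ Fintype.piFinset (fun _ : S₀ ↦ Finset.range 3),
        (∏ v : S₀, ((W.localPolynomialAt (v : IsDedekindDomain.HeightOneSpectrum (NumberField.RingOfIntegers ℚ))).map (Int.castRingHom (PadicAlgCl 2))).coeff (k v) *
            ((Rat.HeightOneSpectrum.natGenerator (v : IsDedekindDomain.HeightOneSpectrum (NumberField.RingOfIntegers ℚ)) : PadicAlgCl 2)⁻¹) ^ (k v)) *
          algebraMap ℚ (PadicAlgCl 2) (ratPlusSymbol f (x * ((∏ v : S₀, Rat.HeightOneSpectrum.natGenerator (v : IsDedekindDomain.HeightOneSpectrum (NumberField.RingOfIntegers ℚ)) ^ (k v) : ℕ) : ℚ))))‖ ≤ 1) ∧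
      ∃ x : ℚ, ‖c * (∑ k ∈ Fintype.piFinset (fun _ : S₀ ↦ Finset.range 3),
        (∏ v : S₀, ((W.localPolynomialAt (v : IsDedekindDomain.HeightOneSpectrum (NumberField.RingOfIntegers ℚ))).map (Int.castRingHom (PadicAlgCl 2))).coeff (k v) *
            ((Rat.HeightOneSpectrum.natGenerator (v : IsDedekindDomain.HeightOneSpectrum (NumberField.RingOfIntegers ℚ)) : PadicAlgCl 2)⁻¹) ^ (k v)) *
          algebraMap ℚ (PadicAlgCl 2) (ratPlusSymbol f (x * ((∏ v : S₀, Rat.HeightOneSpectrum.natGenerator (v : IsDedekindDomain.HeightOneSpectrum (NumberField.RingOfIntegers ℚ)) ^ (k v) : ℕ) : ℚ))))‖ = 1 := by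
  -- common denominator of the rational plus symbols (Manin–Drinfeld)
  obtain ⟨D, hDpos, hD⟩ := exists_forall_ratPlusSymbol_eq_div_of_maninDrinfeld
    (exists_nsmul_modularSymbol_mem_periodLattice_holds f)
  -- numerators `Z x` with `ρ x · B = Z x`
  choose Z hZ using fun x ↦ exists_int_depletedCurveSymbolRat (W := W) (f := f) S₀ hDpos hD x
  set B : ℕ := D * (∏ v : S₀, Rat.HeightOneSpectrum.natGenerator
    (v : IsDedekindDomain.HeightOneSpectrum (NumberField.RingOfIntegers ℚ))) ^ 2 with hBdef
  have hBpos : 0 < B := Nat.mul_pos hDpos (pow_pos (Finset.prod_pos fun v _ ↦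
    (Rat.HeightOneSpectrum.prime_natGenerator _).pos) 2)
  have hB0 : (B : ℚ) ≠ 0 := by exact_mod_cast hBpos.ne'
  have hBK : ‖(B : PadicAlgCl 2)‖ ≠ 0 := norm_ne_zero_iff.mpr (by exact_mod_cast hBpos.ne')
  -- the symbol at `x` is `algebraMap (Z x / B)`
  have hval : ∀ x : ℚ, (∑ k ∈ Fintype.piFinset (fun _ : S₀ ↦ Finset.range 3),
        (∏ v : S₀, ((W.localPolynomialAt (v : IsDedekindDomain.HeightOneSpectrum (NumberField.RingOfIntegers ℚ))).map (Int.castRingHom (PadicAlgCl 2))).coeff (k v) *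
            ((Rat.HeightOneSpectrum.natGenerator (v : IsDedekindDomain.HeightOneSpectrum (NumberField.RingOfIntegers ℚ)) : PadicAlgCl 2)⁻¹) ^ (k v)) *
          algebraMap ℚ (PadicAlgCl 2) (ratPlusSymbol f (x * ((∏ v : S₀, Rat.HeightOneSpectrum.natGenerator (v : IsDedekindDomain.HeightOneSpectrum (NumberField.RingOfIntegers ℚ)) ^ (k v) : ℕ) : ℚ)))) = algebraMap ℚ (PadicAlgCl 2) ((Z x : ℚ) / B) := by
    intro x
    rw [depletedCurveSymbol_eq_algebraMap]
    congr 1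
    rw [eq_div_iff hB0]
    exact hZ x
  have hnorm : ∀ x : ℚ, ‖(∑ k ∈ Fintype.piFinset (fun _ : S₀ ↦ Finset.range 3),
        (∏ v : S₀, ((W.localPolynomialAt (v : IsDedekindDomain.HeightOneSpectrum (NumberField.RingOfIntegers ℚ))).map (Int.castRingHom (PadicAlgCl 2))).coeff (k v) *
            ((Rat.HeightOneSpectrum.natGenerator (v : IsDedekindDomain.HeightOneSpectrum (NumberField.RingOfIntegers ℚ)) : PadicAlgCl 2)⁻¹) ^ (k v)) *
          algebraMap ℚ (PadicAlgCl 2) (ratPlusSymbol f (x * ((∏ v : S₀, Rat.HeightOneSpectrum.natGenerator (v : IsDedekindDomain.HeightOneSpectrum (NumberField.RingOfIntegers ℚ)) ^ (k v) : ℕ) : ℚ))))‖ = ‖(Z x : PadicAlgCl 2)‖ / ‖(B : PadicAlgCl 2)‖ := by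
    intro x
    rw [hval x, map_div₀, map_intCast, map_natCast, norm_div]
  -- non-vanishing at `x = 0`
  have hZ0 : Z 0 ≠ 0 := by
    intro h0
    have hL : W.entireLFunction 1 ≠ 0 := (W.analyticRank_eq_zero_iff_holds hf.hasEntireLFunction).mp hr
    have hsym : ratPlusSymbol f 0 ≠ 0 := fun h ↦ hL (by rw [hf.entireLFunction_one_eq, h]; simp)
    have hprod : (∏ v ∈ S₀, ((W.localPolynomialAt v).map (Int.castRingHom (PadicAlgCl 2))).eval
        ((Rat.HeightOneSpectrum.natGenerator v : PadicAlgCl 2)⁻¹)) ≠ 0 :=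
      Finset.prod_ne_zero_iff.mpr fun v hv ↦ eval_inv_localPolynomialAt_ne_zero v (not_two_dvd_natGenerator (hS2 v hv))
    have hsymK : algebraMap ℚ (PadicAlgCl 2) (ratPlusSymbol f 0) ≠ 0 := by
      rw [Ne, map_eq_zero_iff _ (algebraMap ℚ (PadicAlgCl 2)).injective]
      exact hsym
    have h := hval 0
    rw [depletedCurveSymbol_zero_eq, h0, Int.cast_zero, zero_div, map_zero] at h
    exact (mul_ne_zero hprod hsymK) h
  -- the least `2`-adic valuation of a non-zero numerator
  have hP : ∃ n : ℕ, ∃ x : ℚ, Z x ≠ 0 ∧ padicValInt 2 (Z x) = n := ⟨_, 0, hZ0, rfl⟩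
  obtain ⟨x₀, hx₀, hn₀⟩ := Nat.find_spec hP
  have hmin : ∀ x : ℚ, Z x ≠ 0 → padicValInt 2 (Z x₀) ≤ padicValInt 2 (Z x) := fun x hx ↦ by
    rw [hn₀]; exact Nat.find_min' hP ⟨x, hx, rfl⟩
  have hZx₀ : ‖(Z x₀ : PadicAlgCl 2)‖ ≠ 0 := norm_ne_zero_iff.mpr (by exact_mod_cast hx₀)
  have hΦ0 : (∑ k ∈ Fintype.piFinset (fun _ : S₀ ↦ Finset.range 3),
        (∏ v : S₀, ((W.localPolynomialAt (v : IsDedekindDomain.HeightOneSpectrum (NumberField.RingOfIntegers ℚ))).map (Int.castRingHom (PadicAlgCl 2))).coeff (k v) *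
            ((Rat.HeightOneSpectrum.natGenerator (v : IsDedekindDomain.HeightOneSpectrum (NumberField.RingOfIntegers ℚ)) : PadicAlgCl 2)⁻¹) ^ (k v)) *
          algebraMap ℚ (PadicAlgCl 2) (ratPlusSymbol f (x₀ * ((∏ v : S₀, Rat.HeightOneSpectrum.natGenerator (v : IsDedekindDomain.HeightOneSpectrum (NumberField.RingOfIntegers ℚ)) ^ (k v) : ℕ) : ℚ)))) ≠ 0 := by
    rw [← norm_ne_zero_iff, hnorm]
    exact div_ne_zero hZx₀ hBK
  refine ⟨((∑ k ∈ Fintype.piFinset (fun _ : S₀ ↦ Finset.range 3),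
        (∏ v : S₀, ((W.localPolynomialAt (v : IsDedekindDomain.HeightOneSpectrum (NumberField.RingOfIntegers ℚ))).map (Int.castRingHom (PadicAlgCl 2))).coeff (k v) *
            ((Rat.HeightOneSpectrum.natGenerator (v : IsDedekindDomain.HeightOneSpectrum (NumberField.RingOfIntegers ℚ)) : PadicAlgCl 2)⁻¹) ^ (k v)) *
          algebraMap ℚ (PadicAlgCl 2) (ratPlusSymbol f (x₀ * ((∏ v : S₀, Rat.HeightOneSpectrum.natGenerator (v : IsDedekindDomain.HeightOneSpectrum (NumberField.RingOfIntegers ℚ)) ^ (k v) : ℕ) : ℚ)))))⁻¹, fun x ↦ ?_, x₀, by rw [inv_mul_cancel₀ hΦ0, norm_one]⟩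
  rw [norm_mul, norm_inv, hnorm x, hnorm x₀]
  by_cases hx : Z x = 0
  · rw [hx, Int.cast_zero, norm_zero, zero_div, mul_zero]; exact zero_le_one
  · rw [inv_div, div_mul_div_comm, mul_comm ‖(B : PadicAlgCl 2)‖, mul_div_mul_right _ _ hBK,
      div_le_one (lt_of_le_of_ne (norm_nonneg _) hZx₀.symm), norm_intCast_padicAlgCl_two_eq_zpow hx,
      norm_intCast_padicAlgCl_two_eq_zpow hx₀]
    exact zpow_le_zpow_right₀ (by norm_num) (neg_le_neg (Int.ofNat_le.mpr (hmin x hx)))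

end Primitive

end Summit.BirchSwinnertonDyer.BirchSwinnertonDyer.Theorems.ThetaLayerLambdaCongruenceAtTwo

end
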